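import Literature.Computability.AlgebraicComplexity.ExactVP0Calculus
import Literature.Computability.AlgebraicComplexity.KoiranCriterion
import HarnessLib

/-!
# Koiran's witness family in the PRINTED class `VP⁰` (fan-in exactly two):
# `KData.isExactVP0Family_g`, `KData.isExactVNP0Family_G`, `Burgisser2009_thm41_koiranStep_exact`

Theorem-only companion of `ExactVP0Calculus.lean` (the no-empty-gate calculus `HasTauDeg₁` and
the printed classes `IsExactVP0Family` / `IsExactVNP0Family`: fan-in EXACTLY two, Bürgisser,
*On defining integers …*, Def. 2.7–2.8), `CircuitArithmetizationTau.lean`, `BooleanGadgetsTau.lean`,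
`KoiranCriterionWitness.lean` and `KoiranCriterion.lean` (Koiran's witness family `KData.g` /
`KData.G` for the generalized Valiant criterion, Koiran 2004 Thm. 6.1 = Bürgisser 2009 Thm. 2.11,
as used in the proof of Bürgisser 2009 Thm. 4.1(2); there: `KData.isVP0Family_g`,
`KData.isVNP0Family_G` for the tree's classes `IsVP0Family` / `IsVNP0Family` of fan-in AT MOST
two, registry finding B41). The tree's cost derivations are `HasTauDeg` terms built from
`X / C / 0 / 1 / add / mul / one_sub / rename / finset_sum / finset_prod` only, so they replay
verbatim in `HasTauDeg₁` (same sizes, same formal degrees); the padding lemma packaged as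
`IsExactVP0Family.of_hasTauDeg₁` then gives membership in the printed class. Contents:

* `CircuitArith.hasTauDeg₁_lit/_tableExt/_eqInd/_aeval_wirePoly/_aeval_argPoly/_aeval_consPoly/
  _aeval_validPoly/_aeval_arith` — the transcript arithmetization `arith Q = VALID · OUT` under a
  leaf substitution: `(60 |Q| + 1, 3 |Q| + 2)`;
* `BoolGadgets.hasTauDeg₁_allZeroFrom/_leadBit/_lenInd/_selProd/_eqAll/_ltInd/_leInd`;
* `KoiranW.hasTauDeg₁_of_mem_wpolyK/_σw/_ACC/_TERM/_TERMSUM/_gK` — the witness `gK π` has a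
  no-empty-gate sign-constant circuit of size `gKSize π` and formal degree `gKDeg π`;
* **`KoiranW.KData.isExactVP0Family_g`**, **`KoiranW.KData.isExactVNP0Family_G`** — the witness
  family lies in the PRINTED `VP⁰`, the family `(G_{ℓ,μ})` in the PRINTED `VNP⁰`;
* **`Burgisser2009_thm41_koiranStep_exact`** — the sentence of the discharged fact
  `Burgisser2009_thm41_koiranStep` (`BurgisserTransfer.lean`) with `IsExactVNP0Family` in place of
  `IsVNP0Family` (it implies the tree's sentence via `IsExactVNP0Family.isVNP0Family`; that
  sentence is already the landed `Burgisser2009_thm41_koiranStep_holds`).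

HONEST FRAMING: typed-literature bookkeeping for a 2009 transfer theorem; `VP ≠ VNP` is NOT
proved and nothing here bears on it. No definitions, no facts.

## References

* P. Bürgisser, *On defining integers and proving arithmetic circuit lower bounds*, Comput.
  Complexity 18 (2009) 81–103 = ECCC TR06-113, §2.2, Def. 2.7, Def. 2.8, Thm. 2.11, proof of
  Thm. 4.1(2) [Burgisser2006].
* P. Bürgisser, *Completeness and Reduction in Algebraic Complexity Theory*, Springer 2000,
  Prop. 2.20 and its proof [Burgisser2000].
* P. Koiran, *Valiant's model and the cost of computing integers*, Comput. Complexity 13 (2004),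
  Thm. 6.1 [Koiran2004].
-/

noncomputable section

open MvPolynomial

universe u v w

namespace Literature.Computability.AlgebraicComplexity

open Complexity CircuitArith BoolGadgets _root_.Computability ArithCircuit

/-! ### The arithmetization gadgets (`CircuitArithmetizationTau.lean` replayed in `HasTauDeg₁`) -/

namespace CircuitArith

variable {τ : Type w} {τ' : Type u}

/-- `lit c p`: `(s + 2, max 1 d)`. [cite: Burgisser2000, proof of Prop. 2.20] -/
theorem hasTauDeg₁_lit {p : MvPolynomial τ ℤ} {s d : ℕ} (hp : HasTauDeg₁ p s d) (c : Bool) :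
    HasTauDeg₁ (lit c p) (s + 2) (max 1 d) := by
  cases c
  · exact hp.one_sub
  · exact hp.mono (by omega) (le_max_right _ _)

/-- `tableExt T u v` for leaves `u, v` of size `0` and formal degree `1`: `(26, 2)`. [cite: Burgisser2000, proof of Prop. 2.20] -/
theorem hasTauDeg₁_tableExt (T : Bool → Bool → Bool) {u v : MvPolynomial τ ℤ} (hu : HasTauDeg₁ u 0 1)
    (hv : HasTauDeg₁ v 0 1) : HasTauDeg₁ (tableExt T u v) 26 2 := by
  unfold tableExt
  have hterm : ∀ b0 b1 : Bool, HasTauDeg₁ (if T b0 b1 then lit b0 u * lit b1 v else 0 : MvPolynomial τ ℤ) 5 2 := by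
    intro b0 b1
    split_ifs
    · simpa using (hasTauDeg₁_lit hu b0).mul (hasTauDeg₁_lit hv b1)
    · exact HasTauDeg₁.zero.mono (by omega) (by omega)
  have hinner : ∀ b0 : Bool, HasTauDeg₁ (∑ b1 : Bool, (if T b0 b1 then lit b0 u * lit b1 v else 0 : MvPolynomial τ ℤ)) 12 2 := by
    intro b0
    have h := HasTauDeg₁.finset_sum (Finset.univ : Finset Bool) (s := fun _ => 5) (d := 2)
      fun b1 _ => hterm b0 b1
    simpa using h
  have h := HasTauDeg₁.finset_sum (Finset.univ : Finset Bool) (s := fun _ => 12) (d := 2) fun b0 _ => hinner b0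
  simpa using h

/-- `eqInd y t`: `(sy + st + (sy + st) + 8, max (dy + dt) (max 1 dy + max 1 dt))`. [cite: Burgisser2000, proof of Prop. 2.20] -/
theorem hasTauDeg₁_eqInd {y t : MvPolynomial τ ℤ} {sy dy st dt : ℕ} (hy : HasTauDeg₁ y sy dy) (ht : HasTauDeg₁ t st dt) :
    HasTauDeg₁ (eqInd y t) (2 * (sy + st) + 7) (max (dy + dt) (max 1 dy + max 1 dt)) := by
  unfold eqInd
  have h := (hy.mul ht).add (hy.one_sub.mul ht.one_sub)
  exact h.mono (by omega) le_rfl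

/-! ### The arithmetization under a substitution of the wires -/


variable {ι : Type v}

/-- A substituted wire is a leaf (a value of `g`) or `0`. [cite: Burgisser2000, proof of Prop. 2.20] -/
theorem hasTauDeg₁_aeval_wirePoly {s : ℕ} {g : ι ⊕ Fin s → MvPolynomial τ' ℤ} (hg : ∀ v, HasTauDeg₁ (g v) 0 1)
    (w : ι ⊕ ℕ) : HasTauDeg₁ (aeval g (wirePoly (k := ℤ) s w)) 0 1 := by
  cases w with
  | inl i => simpa [wirePoly] using hg (Sum.inl i)
  | inr m =>
    by_cases h : m < s
    · simpa [wirePoly, h] using hg (Sum.inr ⟨m, h⟩)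
    · simpa [wirePoly, h] using (HasTauDeg₁.zero (σ := τ'))

/-- A substituted argument is a leaf or `0`. [cite: Burgisser2000, proof of Prop. 2.20] -/
theorem hasTauDeg₁_aeval_argPoly {s : ℕ} {g : ι ⊕ Fin s → MvPolynomial τ' ℤ} (hg : ∀ v, HasTauDeg₁ (g v) 0 1)
    (G : Gate ι) (a : ℕ) : HasTauDeg₁ (aeval g (argPoly (k := ℤ) s G a)) 0 1 := by
  unfold argPoly
  split_ifs
  · exact hasTauDeg₁_aeval_wirePoly hg _
  · simpa using (HasTauDeg₁.zero (σ := τ'))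

/-- **The substituted consistency polynomial of a gate**: `(59, 3)`. [cite: Burgisser2000, proof of Prop. 2.20] -/
theorem hasTauDeg₁_aeval_consPoly (Q : Circuit ι) {g : ι ⊕ Fin Q.size → MvPolynomial τ' ℤ}
    (hg : ∀ v, HasTauDeg₁ (g v) 0 1) (j : Fin Q.size) :
    HasTauDeg₁ (aeval g (consPoly (k := ℤ) Q j)) 59 3 := by
  rw [consPoly, aeval_eqInd, aeval_tableExt, aeval_X]
  have h := hasTauDeg₁_eqInd (hg (Sum.inr j))
    (hasTauDeg₁_tableExt (btable (Q.gates[j.val]'j.isLt))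
      (hasTauDeg₁_aeval_argPoly hg (Q.gates[j.val]'j.isLt) 0)
      (hasTauDeg₁_aeval_argPoly hg (Q.gates[j.val]'j.isLt) 1))
  exact h.mono le_rfl (by simp)

/-- **The substituted transcript indicator** `VALID`: `(60 |Q|, 3 |Q| + 1)`. [cite: Burgisser2000, proof of Prop. 2.20] -/
theorem hasTauDeg₁_aeval_validPoly (Q : Circuit ι) {g : ι ⊕ Fin Q.size → MvPolynomial τ' ℤ}
    (hg : ∀ v, HasTauDeg₁ (g v) 0 1) :
    HasTauDeg₁ (aeval g (validPoly (k := ℤ) Q)) (60 * Q.size) (3 * Q.size + 1) := by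
  rw [validPoly, map_prod]
  have h := HasTauDeg₁.finset_prod (Finset.univ : Finset (Fin Q.size)) (s := fun _ => 59) (d := 3)
    fun j _ => hasTauDeg₁_aeval_consPoly Q hg j
  simp only [Finset.sum_const, Finset.card_univ, Fintype.card_fin, smul_eq_mul] at h
  exact h.mono (by omega) (by omega)

/-- **The substituted arithmetization** `arith Q = VALID · OUT`: `(60 |Q| + 1, 3 |Q| + 2)`. [cite: Burgisser2000, proof of Prop. 2.20] -/
theorem hasTauDeg₁_aeval_arith (Q : Circuit ι) {g : ι ⊕ Fin Q.size → MvPolynomial τ' ℤ}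
    (hg : ∀ v, HasTauDeg₁ (g v) 0 1) :
    HasTauDeg₁ (aeval g (arith (k := ℤ) Q)) (60 * Q.size + 1) (3 * Q.size + 2) := by
  rw [arith, map_mul]
  exact ((hasTauDeg₁_aeval_validPoly Q hg).mul (hasTauDeg₁_aeval_wirePoly hg Q.output)).mono (by omega) (by omega)

end CircuitArith

/-! ### The bit-vector gadgets (`BooleanGadgetsTau.lean` §Cost replayed in `HasTauDeg₁`) -/

namespace BoolGadgets

variable {β : Type w}

section Cost

variable {m : ℕ} {E : Fin m → MvPolynomial β ℤ} (hE : ∀ t, HasTauDeg₁ (E t) 0 1)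
include hE

/-- `allZeroFrom E ℓ`: `(3 m, m + 1)`. [cite: Burgisser2006, §2.2] -/
theorem hasTauDeg₁_allZeroFrom (ℓ : ℕ) : HasTauDeg₁ (allZeroFrom E ℓ) (3 * m) (m + 1) := by
  unfold allZeroFrom
  have h := HasTauDeg₁.finset_prod ((Finset.univ : Finset (Fin m)).filter fun t => ℓ ≤ t.val)
    (s := fun _ => 2) (d := 1) fun t _ => by simpa using (hE t).one_sub
  refine h.mono ?_ ?_
  · have hc := Finset.card_filter_le (Finset.univ : Finset (Fin m)) (fun t => ℓ ≤ t.val)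
    rw [Finset.card_univ, Fintype.card_fin] at hc
    simp only [Finset.sum_const, smul_eq_mul]
    omega
  · have hc := Finset.card_filter_le (Finset.univ : Finset (Fin m)) (fun t => ℓ ≤ t.val)
    rw [Finset.card_univ, Fintype.card_fin] at hc
    simpa using hc

/-- `leadBit E ℓ`: `(0, 1)`. [cite: Burgisser2006, §2.2] -/
theorem hasTauDeg₁_leadBit (ℓ : ℕ) : HasTauDeg₁ (leadBit E ℓ) 0 1 := by
  unfold leadBit
  split_ifs
  · exact HasTauDeg₁.one
  · exact hE _
  · exact HasTauDeg₁.zero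

/-- `lenInd E ℓ`: `(3 m + 1, m + 2)`. [cite: Burgisser2006, §2.2] -/
theorem hasTauDeg₁_lenInd (ℓ : ℕ) : HasTauDeg₁ (lenInd E ℓ) (3 * m + 1) (m + 2) := by
  unfold lenInd
  exact ((hasTauDeg₁_leadBit hE ℓ).mul (hasTauDeg₁_allZeroFrom hE ℓ)).mono (by omega) (by omega)

omit hE in
/-- `selProd E Y` for leaves `E_t, Y_t`: `(6 n, 2 n + 1)`. [cite: Burgisser2006, §2.2] -/
theorem hasTauDeg₁_selProd {n : ℕ} {E Y : Fin n → MvPolynomial β ℤ} (hE : ∀ t, HasTauDeg₁ (E t) 0 1)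
    (hY : ∀ t, HasTauDeg₁ (Y t) 0 1) : HasTauDeg₁ (selProd E Y) (6 * n) (2 * n + 1) := by
  unfold selProd
  have h := HasTauDeg₁.finset_prod (Finset.univ : Finset (Fin n)) (s := fun _ => 4) (d := 2)
    fun t _ => (((hE t).mul (hY t)).add (hE t).one_sub).mono (by omega) (by omega)
  simp only [Finset.sum_const, Finset.card_univ, Fintype.card_fin, smul_eq_mul] at h
  exact h.mono (by omega) (by omega)

omit hE in
/-- `eqAll n E F` for leaves: `(8 n, 2 n + 1)`. [cite: Burgisser2006, §2.2] -/
theorem hasTauDeg₁_eqAll : ∀ (n : ℕ) {E F : Fin n → MvPolynomial β ℤ}, (∀ t, HasTauDeg₁ (E t) 0 1) →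
    (∀ t, HasTauDeg₁ (F t) 0 1) → HasTauDeg₁ (eqAll n E F) (8 * n) (2 * n + 1)
  | 0, _, _, _, _ => by simpa [eqAll] using (HasTauDeg₁.one (σ := β))
  | n + 1, E, F, hE, hF => by
    rw [eqAll]
    have h := (hasTauDeg₁_eqInd (hE 0) (hF 0)).mul (hasTauDeg₁_eqAll n (fun t => hE t.succ) (fun t => hF t.succ))
    exact h.mono (by omega) (by omega)

omit hE in
/-- `ltInd n E F` for leaves: `(8 n² + 4 n, 2 n + 2)`. [cite: Burgisser2006, §2.2] -/
theorem hasTauDeg₁_ltInd : ∀ (n : ℕ) {E F : Fin n → MvPolynomial β ℤ}, (∀ t, HasTauDeg₁ (E t) 0 1) →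
    (∀ t, HasTauDeg₁ (F t) 0 1) → HasTauDeg₁ (ltInd n E F) (8 * n * n + 4 * n) (2 * n + 2)
  | 0, _, _, _, _ => by simpa [ltInd] using (HasTauDeg₁.zero (σ := β)).mono le_rfl (by omega)
  | n + 1, E, F, hE, hF => by
    rw [ltInd]
    have h := (hasTauDeg₁_ltInd n (fun t => hE t.succ) (fun t => hF t.succ)).add
      ((hasTauDeg₁_eqAll n (fun t => hE t.succ) (fun t => hF t.succ)).mul ((hE 0).one_sub.mul (hF 0)))
    refine h.mono ?_ (by omega)
    have : 8 * n * n + 4 * n + (8 * n + (0 + 2 + 0 + 1) + 1) + 1 ≤ 8 * (n + 1) * (n + 1) + 4 * (n + 1) := by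
      nlinarith
    exact this

omit hE in
/-- `leInd n E F` for leaves: `(8 n² + 12 n + 1, 2 n + 2)`. [cite: Burgisser2006, §2.2] -/
theorem hasTauDeg₁_leInd (n : ℕ) {E F : Fin n → MvPolynomial β ℤ} (hE : ∀ t, HasTauDeg₁ (E t) 0 1)
    (hF : ∀ t, HasTauDeg₁ (F t) 0 1) : HasTauDeg₁ (leInd n E F) (8 * n * n + 12 * n + 1) (2 * n + 2) := by
  unfold leInd
  exact ((hasTauDeg₁_ltInd n hE hF).add (hasTauDeg₁_eqAll n hE hF)).mono (by omega) (by omega)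

end Cost

end BoolGadgets

/-! ### Koiran's witness (`KoiranCriterionWitness.lean`, `KoiranCriterion.lean` replayed in `HasTauDeg₁`) -/

namespace KoiranW

variable (π : KParams)

/-- Every letter of the polynomial word is a leaf (a digit variable or the constant `0` or `1`). [cite: Burgisser2006, proof of Thm. 4.1(2)] -/
theorem hasTauDeg₁_of_mem_wpolyK {a c d : ℕ} {f : MvPolynomial (D π) ℤ} (hf : f ∈ wpolyK π a c d) :
    HasTauDeg₁ f 0 1 := by
  have hN : ∀ t, HasTauDeg₁ (N' π t) 0 1 := fun t => by
    unfold N'; split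
    · exact HasTauDeg₁.X _
    · exact HasTauDeg₁.zero
  have hK : ∀ t, HasTauDeg₁ (K' π t) 0 1 := fun t => by
    unfold K'; split
    · exact HasTauDeg₁.X _
    · exact HasTauDeg₁.zero
  have hJ : ∀ t, HasTauDeg₁ (J' π t) 0 1 := fun t => by
    unfold J'; split
    · exact HasTauDeg₁.X _
    · exact HasTauDeg₁.zero
  rcases mem_pairG hf with h | h | rfl | rfl
  · rcases mem_pairG h with h | h | rfl | rfl
    · obtain ⟨t, rfl⟩ := (List.mem_ofFn' _ _).1 h
      exact hN t
    · obtain ⟨t, rfl⟩ := (List.mem_ofFn' _ _).1 h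
      exact hK t
    · exact HasTauDeg₁.zero
    · exact HasTauDeg₁.one
  · rcases mem_pairG h with h | h | rfl | rfl
    · obtain ⟨t, rfl⟩ := (List.mem_ofFn' _ _).1 h
      exact hJ t
    · rw [List.mem_singleton] at h
      subst h
      exact HasTauDeg₁.one
    · exact HasTauDeg₁.zero
    · exact HasTauDeg₁.one
  · exact HasTauDeg₁.zero
  · exact HasTauDeg₁.one

/-- Every substituted wire is a leaf: a variable or the constant `0` or `1`. [cite: Burgisser2006, proof of Thm. 4.1(2)] -/
theorem hasTauDeg₁_σw (a c d : ℕ) (v : Fin (L a c d) ⊕ Fin (Qw π a c d).size) : HasTauDeg₁ (σw π a c d v) 0 1 := by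
  cases v with
  | inl i =>
    simp only [σw, Sum.elim_inl]
    rw [List.getD_eq_getElem?_getD]
    cases h : (wpolyK π a c d)[i.val]? with
    | none => exact HasTauDeg₁.zero
    | some f => exact hasTauDeg₁_of_mem_wpolyK π (List.mem_of_getElem? h)
  | inr m =>
    simp only [σw, Sum.elim_inr]
    split
    · exact HasTauDeg₁.X _
    · exact HasTauDeg₁.zero

/-- `ACC a c d` in range: `(60 M + 1, 3 M + 2)`. [cite: Burgisser2006, §2.2] -/
theorem hasTauDeg₁_ACC {a c d : ℕ} (ha : a ≤ π.ℓ + π.μ) (hc : c ≤ π.μ) (hd : d ≤ π.ℓ) :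
    HasTauDeg₁ (ACC π a c d) (60 * π.M + 1) (3 * π.M + 2) := by
  unfold ACC
  rw [← aeval_eq_bind₁]
  have h := hasTauDeg₁_aeval_arith (Qw π a c d) (g := σw π a c d) (hasTauDeg₁_σw π a c d)
  have hs := size_Qw π ha hc hd
  exact h.mono (by omega) (by omega)

/-- **`TERM a c d` in range: `(termSize, termDeg)`.** [cite: Burgisser2006, §2.2] -/
theorem hasTauDeg₁_TERM {a c d : ℕ} (ha : a ≤ π.ℓ + π.μ) (hc : c ≤ π.μ) (hd : d ≤ π.ℓ) :
    HasTauDeg₁ (TERM π a c d) (termSize π) (termDeg π) := by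
  unfold TERM
  have hN : ∀ t, HasTauDeg₁ (Nv π t) 0 1 := fun t => HasTauDeg₁.X _
  have hP : ∀ t, HasTauDeg₁ (Pv π t) 0 1 := fun t => HasTauDeg₁.X _
  have hQ : ∀ t, HasTauDeg₁ (Qv π t) 0 1 := fun t => HasTauDeg₁.X _
  have hJ : ∀ t, HasTauDeg₁ (Jv π t) 0 1 := fun t => HasTauDeg₁.X _
  have hK : ∀ t, HasTauDeg₁ (Kv π t) 0 1 := fun t => HasTauDeg₁.X _
  have h := (((((hasTauDeg₁_lenInd hN a).mul (hasTauDeg₁_lenInd hK c)).mul (hasTauDeg₁_lenInd hJ d)).mul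
    (hasTauDeg₁_leInd π.ℓ hJ hP)).mul (hasTauDeg₁_leInd π.μ hK hQ)).mul (hasTauDeg₁_ACC π ha hc hd)
  refine h.mono ?_ ?_
  · unfold termSize; nlinarith [Nat.zero_le π.ℓ, Nat.zero_le π.μ]
  · unfold termDeg; omega

/-- **`TERMSUM`: `(termSumSize, termDeg)`.** [cite: Burgisser2006, §2.2] -/
theorem hasTauDeg₁_TERMSUM : HasTauDeg₁ (TERMSUM π) (termSumSize π) (termDeg π) := by
  unfold TERMSUM termSumSize
  have hdeg : max 1 (termDeg π) = termDeg π := max_eq_right (by unfold termDeg; omega)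
  have h3 : ∀ a ∈ Finset.range (π.ℓ + π.μ + 1), ∀ c ∈ Finset.range (π.μ + 1),
      HasTauDeg₁ (∑ d ∈ Finset.range (π.ℓ + 1), TERM π a c d) ((π.ℓ + 1) * termSize π + (π.ℓ + 1)) (termDeg π) := by
    intro a ha c hc
    have h := HasTauDeg₁.finset_sum (Finset.range (π.ℓ + 1)) (s := fun _ => termSize π) (d := termDeg π)
      fun d hd => hasTauDeg₁_TERM π (by simpa [Nat.lt_succ_iff] using ha) (by simpa [Nat.lt_succ_iff] using hc)
        (by simpa [Nat.lt_succ_iff] using hd)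
    simp only [Finset.sum_const, Finset.card_range, smul_eq_mul, hdeg] at h
    exact h
  have h2 : ∀ a ∈ Finset.range (π.ℓ + π.μ + 1),
      HasTauDeg₁ (∑ c ∈ Finset.range (π.μ + 1), ∑ d ∈ Finset.range (π.ℓ + 1), TERM π a c d)
        ((π.μ + 1) * ((π.ℓ + 1) * termSize π + (π.ℓ + 1)) + (π.μ + 1)) (termDeg π) := by
    intro a ha
    have h := HasTauDeg₁.finset_sum (Finset.range (π.μ + 1)) (s := fun _ => (π.ℓ + 1) * termSize π + (π.ℓ + 1))
      (d := termDeg π) fun c hc => h3 a ha c hc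
    simp only [Finset.sum_const, Finset.card_range, smul_eq_mul, hdeg] at h
    exact h
  have h := HasTauDeg₁.finset_sum (Finset.range (π.ℓ + π.μ + 1))
    (s := fun _ => (π.μ + 1) * ((π.ℓ + 1) * termSize π + (π.ℓ + 1)) + (π.μ + 1)) (d := termDeg π) h2
  simp only [Finset.sum_const, Finset.card_range, smul_eq_mul, hdeg] at h
  exact h

/-- **The witness `gK` has a constant-free circuit of size `gKSize` and formal degree `gKDeg`.** [cite: Burgisser2006, Def. 2.7] -/
theorem hasTauDeg₁_gK : HasTauDeg₁ (gK π) (gKSize π) (gKDeg π) := by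
  unfold gK gKSize gKDeg
  have hY : HasTauDeg₁ (YSEL π) (6 * π.ℓ) (2 * π.ℓ + 1) :=
    hasTauDeg₁_selProd (fun t => HasTauDeg₁.X _) (fun t => HasTauDeg₁.X _)
  have hZ : HasTauDeg₁ (ZSEL π) (6 * π.μ) (2 * π.μ + 1) :=
    hasTauDeg₁_selProd (fun t => HasTauDeg₁.X _) (fun t => HasTauDeg₁.X _)
  exact ((((hasTauDeg₁_TERMSUM π).rename (ιD π)).mul hY).mul hZ).mono (by omega) (by omega)

namespace KData

variable (K : KData)

/-- **The witness family is in the PRINTED `VP⁰` (fan-in exactly two).** [cite: Burgisser2006, Def. 2.7] -/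
theorem isExactVP0Family_g : IsExactVP0Family (σ := fun r => KoiranVars (Nat.unpair r).1 (Nat.unpair r).2 ⊕ Fin (K.u r)) K.g := by
  have hMp : IsPBounded fun r => K.M (Nat.unpair r).1 (Nat.unpair r).2 :=
    (isPBounded_iff_exists_polynomial_holds _).2 ⟨_, K.M_le⟩
  have hl : IsPBounded fun r => (Nat.unpair r).1 := IsPBounded.id.mono fun r => Nat.unpair_left_le r
  have hm : IsPBounded fun r => (Nat.unpair r).2 := IsPBounded.id.mono fun r => Nat.unpair_right_le r
  have hS : IsPBounded fun r => (Nat.unpair r).1 + (Nat.unpair r).2 + K.M (Nat.unpair r).1 (Nat.unpair r).2 + 1 :=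
    IsPBounded.add_holds (IsPBounded.add_holds (IsPBounded.add_holds hl hm) hMp) (IsPBounded.const 1)
  refine IsExactVP0Family.of_hasTauDeg₁ ?_ (s := fun r => 80 * ((Nat.unpair r).1 + (Nat.unpair r).2 + K.M (Nat.unpair r).1 (Nat.unpair r).2 + 1) ^ 5)
    (d := fun r => 6 * ((Nat.unpair r).1 + (Nat.unpair r).2 + K.M (Nat.unpair r).1 (Nat.unpair r).2) + 14) ?_ ?_ fun r => ?_
  · exact (IsPBounded.mul_holds (IsPBounded.const 4) hS).mono fun r =>
      card_vars_le (Nat.unpair r).1 (Nat.unpair r).2 (K.M (Nat.unpair r).1 (Nat.unpair r).2)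
  · exact IsPBounded.mul_holds (IsPBounded.const 80) (IsPBounded.pow_holds hS 5)
  · exact IsPBounded.add_holds (IsPBounded.mul_holds (IsPBounded.const 6)
      (IsPBounded.add_holds (IsPBounded.add_holds hl hm) hMp)) (IsPBounded.const 14)
  · exact ((hasTauDeg₁_gK (K.params (Nat.unpair r).1 (Nat.unpair r).2)).rename _).mono
      (gKSize_le (K.params _ _)) (gKDeg_le (K.params _ _))

/-- **The family `(G_{ℓ,μ})` is in the PRINTED `VNP⁰`** (fan-in exactly two; indexed by `r ↦ Nat.unpair r`). [cite: Burgisser2006, Def. 2.8 with Thm. 2.11] -/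
theorem isExactVNP0Family_G : IsExactVNP0Family (σ := fun r => KoiranVars (Nat.unpair r).1 (Nat.unpair r).2)
    fun r => K.G (Nat.unpair r).1 (Nat.unpair r).2 :=
  ⟨K.u, K.g, K.isExactVP0Family_g, fun _ => (DefVNP.boolSum_rename_equiv (k := ℤ) _ _).symm⟩

end KData

end KoiranW

/-! ### The Koiran step of Bürgisser 2009, Thm. 4.1(2), with the witness in the PRINTED `VNP⁰` -/

/-- **`Burgisser2009_thm41_koiranStep` in the printed reading of `VNP⁰`** (fan-in exactly two,
Bürgisser 2009 Def. 2.7–2.8): the two-block interpolating polynomials of a `P/poly`-decidable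
0/1 array are substitution instances of one family in the PRINTED class `VNP⁰`
(`IsExactVNP0Family`; the tree's discharged fact states it for the larger class `IsVNP0Family`,
registry B41). Same witness `KData.G`, same proof, membership by `KData.isExactVNP0Family_G`.
[cite: Burgisser2006, proof of Thm. 4.1(2), p. 14–15 (via Thm. 2.11 = Koiran2004 Thm. 6.1); Def. 2.7–2.8] -/
theorem Burgisser2009_thm41_koiranStep_exact :
    ∀ (p q : ℕ → ℕ), IsPBounded p → IsPBounded q → (∀ n, n ≤ p n) →
    ∀ (b : ℕ → ℕ → ℕ → Bool),
      (∃ B ∈ PPoly, ∀ n k j, k ≤ q n → j ≤ p n → (encBitQuery n k j true ∈ B ↔ b n k j = true)) →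
        ∃ G : ∀ ℓ μ : ℕ, MvPolynomial (KoiranVars ℓ μ) ℤ,
          IsExactVNP0Family (σ := fun r => KoiranVars (Nat.unpair r).1 (Nat.unpair r).2)
              (fun r => G (Nat.unpair r).1 (Nat.unpair r).2) ∧
            ∀ n, twoBlockPoly p q b n = aeval (blockSubst p q n) (G (bitLen (p n)) (bitLen (q n))) := by
  intro p q _ _ hpn b hB
  obtain ⟨B, hBP, hb⟩ := hB
  simp only [PPoly, Set.mem_iUnion] at hBP
  obtain ⟨sB, C, hC, hdec⟩ := hBP
  let K : KoiranW.KData := ⟨sB, C, fun m => (hC m).1, fun m => (hC m).2⟩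
  exact ⟨K.G, K.isExactVNP0Family_G, fun n => (K.aeval_blockSubst_G p q hpn b B hb hdec n).symm⟩

end Literature.Computability.AlgebraicComplexity
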